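import Summits.HodgeConjecture.CorCM.IrreducibleOddWeightsHellyIntrinsic
import Summits.HodgeConjecture.CorCM.CMAbelianFourfoldPowers
import HarnessLib

/-!
# The Hodge conjecture for products of complex abelian varieties of CM type of dimension `≤ q ≤ 3` whose Hodge groups
# are multiplicative `q + 1` AT A TIME — unconditionally (curves: PAIRS; surfaces: TRIPLES; threefolds: QUADRUPLES)

COR-CM (cell `pub-hodgecm2`, binder seat `b16` gen 61, count-neutral claim BLOCKS ARE MEMBERS, file H8 — complex abelian
varieties of CM type, NO CM data in the statements; theorems only, no definition, no named fact, no `sorry`).  NEW as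
stated, hence under `Summits/`.  HONEST FRAMING: an UNCONDITIONAL instance family of the Hodge conjecture (products of
copies of CM abelian varieties of dimension `≤ 3` under a finite Mumford–Tate rank hypothesis on small sub-products);
`HC_CM` is neither used nor asserted.

File H5 (`IrreducibleOddWeightsHellyIntrinsic`): for `X : Fin n → AbelianVariety ℂ` of CM type with
`t(X_j) = dim MT(H¹ X_j) ≤ q + 1`, the identity `t(⨁_S X_j) + |S| = Σ_S t(X_j) + 1` (`Hg(∏_S X_j) = ∏_S Hg(X_j)`) for all
non-empty `S` with `|S| ≤ q + 1`, together with the Hodge conjecture for the powers `X_j^{N+1}`, gives the Hodge conjecture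
for every product of copies.  The tree's `CMAbelianVarietyDimLeThreePowers` (Moonen–Zarhin (5.2), CM case): every power of
a complex abelian variety of CM type of dimension `≤ 3` is divisor-generated, UNCONDITIONALLY; and
`mtRank_hodge_one_le_dim_add_one_of_isOfCMType`: `t(X_j) ≤ dim X_j + 1`.  Hence:

* **`hodgeConjectureFor_biproduct_of_dim_le_of_forall_card_le`** — `X_j` of CM type, `0 < dim X_j ≤ q ≤ 3`, and
  `t(⨁_S X_j) + |S| = Σ_S t(X_j) + 1` for every non-empty `S ⊆ Fin n` with `|S| ≤ q + 1` (any witnesses) ⟹ the Hodge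
  conjecture for every `⨁_{k ∈ J} X_{π k}` and everything isogenous (`…_of_isIsogenous_…`);
* **`hodgeConjectureFor_biproduct_of_dim_le_three_of_forall_card_le_four`** — CM abelian varieties of dimension `≤ 3`
  whose Hodge groups are multiplicative FOUR AT A TIME; `…_dim_le_two_…_three` (CM curves and surfaces, THREE at a time);
  `…_dim_le_one_…_two` (CM elliptic curves, PAIRWISE — the classical Imai–Murty situation, here from the rank identity
  on pairs).
* **`hodgeConjectureFor_biproduct_of_dim_le_four_of_forall_card_le_five`** — dimension `≤ 4`, the FOUR-dimensional
  factors divisor-generated (`B•(X_j) = D•(X_j)`: the tree's `CMAbelianFourfoldPowers` = Moonen–Zarhin (0.1), neither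
  `E × T` with `End⁰(E) ↪ End⁰(T)` nor simple degenerate; then all their powers are divisor-generated), Hodge groups
  multiplicative FIVE at a time ⟹ the Hodge conjecture for every product of copies — still unconditional.

The rank hypothesis cannot be weakened to fewer factors at a time: file H7 (`IrreducibleOddWeightsHellySharp`) has three
CM surfaces, pairwise multiplicative, jointly not.

## References

* [MoonenZarhin1999LowDim] B. Moonen, Yu. Zarhin, *Hodge classes on abelian varieties of low dimension*, Math. Ann.
  315 (1999), Thm. (0.1), §3 (3.1), §5 (5.2).
* [Gordon1999HodgeAVSurvey] B. B. Gordon, *A survey of the Hodge conjecture for abelian varieties*, §3 Theorem (Imai,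
  Murty) with proof; 7.4–7.7.
* [Mai1989] L. Mai, *Lower bounds for the ranks of CM types*, J. Number Theory 32 (1989), §2 Prop. 1 (proof).
* [vanGeemen1994HodgeAV] B. van Geemen, LNM 1594 (1994), §2.4, §3.5–3.7 Lemma 3.7.
* [Milne1999LefschetzClasses] J. S. Milne, *Lefschetz classes on abelian varieties*, Duke Math. J. 96 (1999), §1
  Prop. 1.1.
-/

set_option autoImplicit false

noncomputable section

open scoped BigOperators

open CategoryTheory CategoryTheory.Limits NumberField

namespace Summit.HodgeConjecture.CorCM

open Literature.AlgebraicGeometry.Motives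
open Literature.AlgebraicGeometry.Motives.AbelianVariety
open Literature.AlgebraicGeometry.HodgeTheory
open Literature.AlgebraicGeometry.Milne1999 (IsOfCMType)

section DimLe

variable [HodgeTensorFacts.{0, 0}]

/-- **THE HODGE CONJECTURE FOR PRODUCTS OF CM ABELIAN VARIETIES OF DIMENSION `≤ q ≤ 3` WITH HODGE GROUPS MULTIPLICATIVE
`q + 1` AT A TIME.**  `X : Fin n → AbelianVariety ℂ` of CM type with `0 < dim X_j ≤ q`, `q ≤ 3`; `t(Y) = dim MT(H¹(Y))` (any
smooth-projective witnesses).  IF `t(⨁_{j ∈ S} X_j) + |S| = Σ_{j ∈ S} t(X_j) + 1` — `Hg(∏_S X_j) = ∏_S Hg(X_j)` — for every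
non-empty `S` with `|S| ≤ q + 1`, THEN the Hodge conjecture holds for every product of copies `⨁_{k ∈ J} X_{π k}`.
UNCONDITIONAL: the powers `X_j^{N+1}` are divisor-generated (Moonen–Zarhin (5.2), CM case: the tree's `CMAbelianVarietyDimLeThreePowers`), `t(X_j) ≤ dim X_j + 1`,
and H5's intrinsic Helly gluing. [cite: MoonenZarhin1999LowDim, §3 (3.1) and §5 (5.2)] [cite: Mai1989, §2 Prop. 1 (proof)]
[cite: vanGeemen1994HodgeAV, §2.4 and §3.5–3.7 Lemma 3.7 (p. 236)] [cite: Gordon1999HodgeAVSurvey, 7.4–7.7] -/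
theorem hodgeConjectureFor_biproduct_of_dim_le_of_forall_card_le {n : ℕ} [NeZero n] (X : Fin n → AbelianVariety ℂ)
    (hX0 : ∀ j, 0 < (X j).dim) (hcm : ∀ j, IsOfCMType (X j)) (q : ℕ) (hq3 : q ≤ 3) (hq : ∀ j, (X j).dim ≤ q)
    {kX : Fin n → ℕ} (hX : ∀ j, IsSmoothProjective (kX j) (X j).X)
    (hS : ∀ (S : Finset (Fin n)), S.Nonempty → S.card ≤ q + 1 → ∀ {kS : ℕ}
      (hS : IsSmoothProjective kS (⨁ fun j : {j // j ∈ S} => X j.1).X),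
        haveI := BettiUniverse.finite hS 1
        haveI := fun j => BettiUniverse.finite (hX j) 1
        (BettiUniverse.hodge exists_isReal_hodgeModel_holds hS 1).mtRank + S.card =
          (∑ j ∈ S, (BettiUniverse.hodge exists_isReal_hodgeModel_holds (hX j) 1).mtRank) + 1)
    {J : Type} [Fintype J] [Nonempty J] (π : J → Fin n) :
    HodgeConjectureFor (⨁ fun k => X (π k)).dim (⨁ fun k => X (π k)).X :=
  hodgeConjectureFor_biproduct_of_forall_card_le_of_mtRank_le X hX0 hcm hX q
    (fun j => (mtRank_hodge_one_le_dim_add_one_of_isOfCMType (hX j) (hX0 j) (hcm j)).trans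
      (Nat.add_le_add_right (hq j) 1))
    hS (fun j N => hodgeConjectureFor_of_isDivisorGenerated _
      (isDivisorGenerated_powSucc_of_isOfCMType_of_dim_le_three (hcm j) ((hq j).trans hq3) N)) π

/-- **Isogenous carriers**: under the same hypotheses the Hodge conjecture holds for every complex abelian variety
isogenous to a product of copies `⨁_k X_{π k}` (e.g. `∏_j X_j^{a_j}` in any bracketing).
[cite: vanGeemen1994HodgeAV, §3.5–3.7 Lemma 3.7 (p. 236)] [cite: MoonenZarhin1999LowDim, §3 (3.1) and §5 (5.2)] -/
theorem hodgeConjectureFor_of_isIsogenous_biproduct_of_dim_le_of_forall_card_le {n : ℕ} [NeZero n]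
    (X : Fin n → AbelianVariety ℂ) (hX0 : ∀ j, 0 < (X j).dim) (hcm : ∀ j, IsOfCMType (X j)) (q : ℕ) (hq3 : q ≤ 3)
    (hq : ∀ j, (X j).dim ≤ q) {kX : Fin n → ℕ} (hX : ∀ j, IsSmoothProjective (kX j) (X j).X)
    (hS : ∀ (S : Finset (Fin n)), S.Nonempty → S.card ≤ q + 1 → ∀ {kS : ℕ}
      (hS : IsSmoothProjective kS (⨁ fun j : {j // j ∈ S} => X j.1).X),
        haveI := BettiUniverse.finite hS 1
        haveI := fun j => BettiUniverse.finite (hX j) 1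
        (BettiUniverse.hodge exists_isReal_hodgeModel_holds hS 1).mtRank + S.card =
          (∑ j ∈ S, (BettiUniverse.hodge exists_isReal_hodgeModel_holds (hX j) 1).mtRank) + 1)
    {J : Type} [Fintype J] [Nonempty J] (π : J → Fin n) {Y : AbelianVariety ℂ}
    (hY : IsIsogenous Y (⨁ fun k => X (π k))) : HodgeConjectureFor Y.dim Y.X :=
  HodgeConjectureFor.of_isIsogenous hY
    (hodgeConjectureFor_biproduct_of_dim_le_of_forall_card_le X hX0 hcm q hq3 hq hX hS π)

/-- **CM ABELIAN VARIETIES OF DIMENSION `≤ 3`, HODGE GROUPS MULTIPLICATIVE FOUR AT A TIME ⟹ the Hodge conjecture for every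
product of copies** (CM elliptic curves, CM surfaces, CM threefolds mixed; simple or not, degenerate products inside a
factor allowed). [cite: MoonenZarhin1999LowDim, §3 (3.1) and §5 (5.2)] [cite: Gordon1999HodgeAVSurvey, 7.4–7.7] -/
theorem hodgeConjectureFor_biproduct_of_dim_le_three_of_forall_card_le_four {n : ℕ} [NeZero n]
    (X : Fin n → AbelianVariety ℂ) (hX0 : ∀ j, 0 < (X j).dim) (hcm : ∀ j, IsOfCMType (X j))
    (h3 : ∀ j, (X j).dim ≤ 3) {kX : Fin n → ℕ} (hX : ∀ j, IsSmoothProjective (kX j) (X j).X)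
    (hS : ∀ (S : Finset (Fin n)), S.Nonempty → S.card ≤ 4 → ∀ {kS : ℕ}
      (hS : IsSmoothProjective kS (⨁ fun j : {j // j ∈ S} => X j.1).X),
        haveI := BettiUniverse.finite hS 1
        haveI := fun j => BettiUniverse.finite (hX j) 1
        (BettiUniverse.hodge exists_isReal_hodgeModel_holds hS 1).mtRank + S.card =
          (∑ j ∈ S, (BettiUniverse.hodge exists_isReal_hodgeModel_holds (hX j) 1).mtRank) + 1)
    {J : Type} [Fintype J] [Nonempty J] (π : J → Fin n) :
    HodgeConjectureFor (⨁ fun k => X (π k)).dim (⨁ fun k => X (π k)).X :=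
  hodgeConjectureFor_biproduct_of_dim_le_of_forall_card_le X hX0 hcm 3 le_rfl h3 hX hS π

/-- **CM CURVES AND SURFACES, HODGE GROUPS MULTIPLICATIVE THREE AT A TIME ⟹ the Hodge conjecture for every product of
copies.**  (Three at a time is necessary for surfaces: `IrreducibleOddWeightsHellySharp`.)
[cite: MoonenZarhin1999LowDim, "Hodge groups of simple abelian surfaces of CM-type", §3 (3.1) and §5 (5.2)] -/
theorem hodgeConjectureFor_biproduct_of_dim_le_two_of_forall_card_le_three {n : ℕ} [NeZero n]
    (X : Fin n → AbelianVariety ℂ) (hX0 : ∀ j, 0 < (X j).dim) (hcm : ∀ j, IsOfCMType (X j))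
    (h2 : ∀ j, (X j).dim ≤ 2) {kX : Fin n → ℕ} (hX : ∀ j, IsSmoothProjective (kX j) (X j).X)
    (hS : ∀ (S : Finset (Fin n)), S.Nonempty → S.card ≤ 3 → ∀ {kS : ℕ}
      (hS : IsSmoothProjective kS (⨁ fun j : {j // j ∈ S} => X j.1).X),
        haveI := BettiUniverse.finite hS 1
        haveI := fun j => BettiUniverse.finite (hX j) 1
        (BettiUniverse.hodge exists_isReal_hodgeModel_holds hS 1).mtRank + S.card =
          (∑ j ∈ S, (BettiUniverse.hodge exists_isReal_hodgeModel_holds (hX j) 1).mtRank) + 1)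
    {J : Type} [Fintype J] [Nonempty J] (π : J → Fin n) :
    HodgeConjectureFor (⨁ fun k => X (π k)).dim (⨁ fun k => X (π k)).X :=
  hodgeConjectureFor_biproduct_of_dim_le_of_forall_card_le X hX0 hcm 2 (by norm_num) h2 hX hS π

/-- **CM ELLIPTIC CURVES, HODGE GROUPS MULTIPLICATIVE PAIRWISE (`Hg(E_i × E_j) = Hg(E_i) × Hg(E_j)`, i.e. pairwise
non-isogenous) ⟹ the Hodge conjecture for every product of copies** — the Imai–Murty situation, here through the rank
identity on pairs. [cite: Gordon1999HodgeAVSurvey, §3 Theorem (Imai, Murty) with proof] [cite: MoonenZarhin1999LowDim, §3 (3.1)] -/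
theorem hodgeConjectureFor_biproduct_of_dim_le_one_of_forall_card_le_two {n : ℕ} [NeZero n]
    (X : Fin n → AbelianVariety ℂ) (hX0 : ∀ j, 0 < (X j).dim) (hcm : ∀ j, IsOfCMType (X j))
    (h1 : ∀ j, (X j).dim ≤ 1) {kX : Fin n → ℕ} (hX : ∀ j, IsSmoothProjective (kX j) (X j).X)
    (hS : ∀ (S : Finset (Fin n)), S.Nonempty → S.card ≤ 2 → ∀ {kS : ℕ}
      (hS : IsSmoothProjective kS (⨁ fun j : {j // j ∈ S} => X j.1).X),
        haveI := BettiUniverse.finite hS 1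
        haveI := fun j => BettiUniverse.finite (hX j) 1
        (BettiUniverse.hodge exists_isReal_hodgeModel_holds hS 1).mtRank + S.card =
          (∑ j ∈ S, (BettiUniverse.hodge exists_isReal_hodgeModel_holds (hX j) 1).mtRank) + 1)
    {J : Type} [Fintype J] [Nonempty J] (π : J → Fin n) :
    HodgeConjectureFor (⨁ fun k => X (π k)).dim (⨁ fun k => X (π k)).X :=
  hodgeConjectureFor_biproduct_of_dim_le_of_forall_card_le X hX0 hcm 1 (by norm_num) h1 hX hS π

/-- **DIMENSION `≤ 4`: CM abelian varieties of dimension `≤ 4`, the four-dimensional ones divisor-generated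
(`B•(X_j) = D•(X_j)`), Hodge groups multiplicative FIVE AT A TIME ⟹ the Hodge conjecture for every product of copies**,
unconditionally: powers of CM abelian varieties of dimension `≤ 3` and of divisor-generated CM fourfolds are
divisor-generated (Moonen–Zarhin (5.2), (0.1) (4)), `t(X_j) ≤ dim X_j + 1 ≤ 5`, and H5's intrinsic Helly gluing.
[cite: MoonenZarhin1999LowDim, Thm. (0.1) (4), §3 (3.1) and §5 (5.2)] [cite: Gordon1999HodgeAVSurvey, 7.4–7.7 and 10.10]
[cite: vanGeemen1994HodgeAV, §2.4 and §3.5–3.7 Lemma 3.7 (p. 236)] -/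
theorem hodgeConjectureFor_biproduct_of_dim_le_four_of_forall_card_le_five {n : ℕ} [NeZero n]
    (X : Fin n → AbelianVariety ℂ) (hX0 : ∀ j, 0 < (X j).dim) (hcm : ∀ j, IsOfCMType (X j))
    (h4 : ∀ j, (X j).dim ≤ 4) (hD : ∀ j, (X j).dim = 4 → IsDivisorGenerated (X j)) {kX : Fin n → ℕ}
    (hX : ∀ j, IsSmoothProjective (kX j) (X j).X)
    (hS : ∀ (S : Finset (Fin n)), S.Nonempty → S.card ≤ 5 → ∀ {kS : ℕ}
      (hS : IsSmoothProjective kS (⨁ fun j : {j // j ∈ S} => X j.1).X),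
        haveI := BettiUniverse.finite hS 1
        haveI := fun j => BettiUniverse.finite (hX j) 1
        (BettiUniverse.hodge exists_isReal_hodgeModel_holds hS 1).mtRank + S.card =
          (∑ j ∈ S, (BettiUniverse.hodge exists_isReal_hodgeModel_holds (hX j) 1).mtRank) + 1)
    {J : Type} [Fintype J] [Nonempty J] (π : J → Fin n) :
    HodgeConjectureFor (⨁ fun k => X (π k)).dim (⨁ fun k => X (π k)).X := by
  refine hodgeConjectureFor_biproduct_of_forall_card_le_of_mtRank_le X hX0 hcm hX 4
    (fun j => (mtRank_hodge_one_le_dim_add_one_of_isOfCMType (hX j) (hX0 j) (hcm j)).trans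
      (Nat.add_le_add_right (h4 j) 1)) hS (fun j N => ?_) π
  rcases (h4 j).lt_or_eq with hlt | heq
  · exact hodgeConjectureFor_of_isDivisorGenerated _
      (isDivisorGenerated_powSucc_of_isOfCMType_of_dim_le_three (hcm j) (Nat.lt_succ_iff.mp hlt) N)
  · exact hodgeConjectureFor_powSucc_of_isDivisorGenerated_of_dim_four (hcm j) heq (hD j heq) N

end DimLe

end Summit.HodgeConjecture.CorCM

end
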